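import Literature.NumberTheory.DiophantineApproximation.IrrationalFormsTransference
import Literature.NumberTheory.Transcendental.NesterenkoCriterion
import HarnessLib

/-!
# Integer linear forms in `1, ξ₁, …, ξ_k` cannot be too small — a transference lemma

Topic `Literature/NumberTheory/DiophantineApproximation`. Everything in this file is PROVED.

**Lemma** (`no_integer_forms`). Let `ξ₁, …, ξ_k` be real numbers (no irrationality or
independence hypothesis) and let `ℓ_n = P_n + ∑ᵢ Q_{n,i} ξᵢ` (`P_n, Q_{n,i} ∈ ℤ`) be integer linear
forms with, for all large `n`, `e^{-A₁ n} ≤ |ℓ_n| ≤ e^{-A₂ n}` and `|Q_{n,i}| ≤ e^{B n}`, where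
`0 < A₂ ≤ A₁`, `0 ≤ B`. If `k B < A₂` and `k (A₁ + B) < (k + 1) A₂`, this is impossible.

This is the two-rate, dimension-`k` form of the core of Nesterenko's linear independence
criterion (Yu. V. Nesterenko, *On the linear independence of numbers*, Vestnik Moskov. Univ.
Ser. I Mat. Mekh. (1985) no. 1, 46–49, Theorem 1): for `B > 0`, with `σ(n) = B n`, `τ₁ = A₁/B`,
`τ₂ = A₂/B`, Nesterenko's theorem gives `dim_ℚ (ℚ + ℚ ξ₁ + ⋯ + ℚ ξ_k) ≥ (1 + τ₁)/(1 + τ₁ - τ₂)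
= (A₁ + B)/(A₁ + B - A₂)`, which exceeds `k + 1` exactly when `k (A₁ + B) < (k + 1) A₂` — so no
such forms exist. (The hypothesis `k B < A₂` follows from the other ones; it is the condition under
which the auxiliary integer below vanishes, and is kept to match the one-variable lemma
`no_integer_forms_of_irrational` of `IrrationalFormsTransference.lean`, the case `k = 1`.) Only
exponential upper and lower bounds for the forms are assumed, not an exact asymptotic rate; this is
what is needed to turn Hermite–Padé forms in `1, Li₁(1/N), …, Li_w(1/N)` into a proof of linear
independence once a hypothetical relation has been used to eliminate one polylogarithm.

Proof: the transference argument (S. Fischler, W. Zudilin, *A refinement of Nesterenko's linear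
independence criterion with applications to zeta values*, Math. Ann. 347 (2010) 739–763, §2) run
over Dirichlet's simultaneous approximation theorem (the box principle,
`Literature.NumberTheory.Transcendental.NesterenkoCriterion.exists_simultaneous_approx`) instead of
Minkowski's theorem. For `M ≥ 1` the box principle gives `1 ≤ q ≤ M^k` with
`|q ξᵢ - round (q ξᵢ)| < 1/M` for all `i`.
* If `q` stays below a fixed `q₀` this contradicts the positivity of
  `Ψ(q) = ∑ᵢ |q ξᵢ - round (q ξᵢ)|` on `[1, q₀)`: `Ψ(q) = 0` would make all `q ξᵢ` integral, and
  then `q ℓ_n` would be a non-zero integer of absolute value `≤ q e^{-A₂ n} < 1`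
  (`not_forall_nat_mul_eq_round`).
* If `q ≥ q₀ = e^{A₂ n₀}`, put `n = ⌈log (2q)/A₂⌉ ≥ n₀`. The integer
  `I = q P_n + ∑ᵢ Q_{n,i} round (q ξᵢ) = q ℓ_n - ∑ᵢ Q_{n,i} (q ξᵢ - round (q ξᵢ))` has
  `|I| ≤ q e^{-A₂ n} + k e^{B n}/M ≤ 1/2 + k e^{B} 2^{B/A₂} M^{k B/A₂ - 1} < 1` for `M` large
  (as `k B < A₂`), so `I = 0`; then `q e^{-A₁ n} ≤ q |ℓ_n| ≤ k e^{B n}/M` gives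
  `M ≤ k e^{(A₁ + B) n}/q ≤ k e^{A₁+B} 2^θ q^{θ - 1} ≤ k e^{A₁+B} 2^θ M^{k(θ-1)}`,
  `θ = (A₁ + B)/A₂ ≥ 1`, impossible for `M` large since `k (θ - 1) < 1`.
All estimates are carried out on the logarithmic scale `log q`, `log M`.

## References

* Yu. V. Nesterenko, *On the linear independence of numbers*, Vestnik Moskov. Univ. Ser. I Mat.
  Mekh. (1985) no. 1, 46–49; Moscow Univ. Math. Bull. 40 (1985) 69–74, Theorem 1. [Nesterenko1985]
* S. Fischler, W. Zudilin, *A refinement of Nesterenko's linear independence criterion with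
  applications to zeta values*, Math. Ann. 347 (2010) 739–763, §2 (the transference principle).
* The one-variable case (`k = 1`, `ξ` irrational):
  `Literature.NumberTheory.DiophantineApproximation.no_integer_forms_of_irrational`.
-/

namespace Literature.NumberTheory.DiophantineApproximation

open _root_.Filter _root_.Topology
open _root_.Literature.NumberTheory.Transcendental.NesterenkoCriterion (exists_simultaneous_approx
  distSum distSum_nonneg)

/-- If integer linear forms `ℓ_n = P_n + ∑ᵢ Q_{n,i} ξᵢ` satisfy `e^{-A₁ n} ≤ |ℓ_n| ≤ e^{-A₂ n}`
(`A₂ > 0`) for all large `n`, then no positive integer `q` makes all the `q ξᵢ` integral: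
otherwise `q ℓ_n = q P_n + ∑ᵢ Q_{n,i} (q ξᵢ)` is a non-zero integer of absolute value
`≤ q e^{-A₂ n} < 1` for `n` large. [folklore] -/
theorem not_forall_nat_mul_eq_round {k : ℕ} (ξ : Fin k → ℝ) {A₁ A₂ : ℝ} (hA₂ : 0 < A₂)
    (P : ℕ → ℤ) (Q : ℕ → Fin k → ℤ)
    (hlow : ∀ᶠ n : ℕ in atTop,
      Real.exp (-(A₁ * n)) ≤ |(P n : ℝ) + ∑ i, (Q n i : ℝ) * ξ i|)
    (hup : ∀ᶠ n : ℕ in atTop,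
      |(P n : ℝ) + ∑ i, (Q n i : ℝ) * ξ i| ≤ Real.exp (-(A₂ * n)))
    {q : ℕ} (hq : 0 < q) (hint : ∀ i, (q : ℝ) * ξ i = round ((q : ℝ) * ξ i)) : False := by
  obtain ⟨n₀, hn₀⟩ := eventually_atTop.1 (hlow.and hup)
  have hqpos : (0 : ℝ) < q := by exact_mod_cast hq
  -- an index `n ≥ n₀` with `q e^{-A₂ n} < 1`
  obtain ⟨n, hn₀n, hn⟩ : ∃ n : ℕ, n₀ ≤ n ∧ Real.log q < A₂ * n := by
    refine ⟨n₀ + (⌊Real.log q / A₂⌋₊ + 1), Nat.le_add_right _ _, ?_⟩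
    have h1 : Real.log q / A₂ < ⌊Real.log q / A₂⌋₊ + 1 := Nat.lt_floor_add_one _
    rw [div_lt_iff₀ hA₂] at h1
    have h2 : (0 : ℝ) ≤ A₂ * n₀ := mul_nonneg hA₂.le n₀.cast_nonneg
    push_cast
    linarith
  obtain ⟨hlow', hup'⟩ := hn₀ n hn₀n
  -- the integer `J = q P_n + ∑ᵢ Q_{n,i} round (q ξᵢ)` equals `q ℓ_n`
  obtain ⟨J, hJ⟩ : ∃ J : ℤ, (J : ℝ) = q * ((P n : ℝ) + ∑ i, (Q n i : ℝ) * ξ i) := by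
    refine ⟨q * P n + ∑ i, Q n i * round ((q : ℝ) * ξ i), ?_⟩
    push_cast
    rw [mul_add, Finset.mul_sum]
    congr 1
    exact Finset.sum_congr rfl fun i _ => by rw [← hint i]; ring
  have hJ1 : |(J : ℝ)| < 1 := by
    rw [hJ, abs_mul, Nat.abs_cast]
    calc (q : ℝ) * |(P n : ℝ) + ∑ i, (Q n i : ℝ) * ξ i| ≤ q * Real.exp (-(A₂ * n)) :=
          mul_le_mul_of_nonneg_left hup' hqpos.le
      _ < 1 := by
          rw [Real.exp_neg, ← div_eq_mul_inv, div_lt_one (Real.exp_pos _), ← Real.exp_log hqpos]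
          exact Real.exp_lt_exp.2 hn
  have hJ0 : (J : ℝ) ≠ 0 := by
    rw [hJ]
    exact mul_ne_zero hqpos.ne' (abs_pos.1 ((Real.exp_pos _).trans_le hlow'))
  have hJ1' : ((|J| : ℤ) : ℝ) < (1 : ℤ) := by rw [Int.cast_abs, Int.cast_one]; exact hJ1
  have hJz : J = 0 := Int.abs_lt_one_iff.1 (Int.cast_lt.1 hJ1')
  exact hJ0 (by rw [hJz, Int.cast_zero])

/-- **Integer linear forms in `1, ξ₁, …, ξ_k` cannot be too small** (Nesterenko's 1985 linear
independence criterion for the at most `(k+1)`-dimensional span of `1, ξ₁, …, ξ_k`, in two-rate,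
contrapositive form). Let `ξ : Fin k → ℝ`, `0 < A₂ ≤ A₁`, `0 ≤ B` with `k B < A₂` and
`k (A₁ + B) < (k + 1) A₂`. Then there is NO sequence of integer linear forms
`ℓ_n = P_n + ∑ᵢ Q_{n,i} ξᵢ` with `e^{-A₁ n} ≤ |ℓ_n| ≤ e^{-A₂ n}` and `|Q_{n,i}| ≤ e^{B n}` for all
large `n`. No hypothesis on `ξ` is needed. Proof by transference over Dirichlet's simultaneous
approximation theorem (Fischler–Zudilin), see the module docstring.
[cite: Nesterenko1985, Theorem 1 (two-rate form for the span of 1 and k numbers)] -/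
theorem no_integer_forms {k : ℕ} (ξ : Fin k → ℝ) {A₁ A₂ B : ℝ}
    (hA₂ : 0 < A₂) (hA : A₂ ≤ A₁) (hB : 0 ≤ B)
    (hgap₁ : (k : ℝ) * B < A₂) (hgap₂ : (k : ℝ) * (A₁ + B) < ((k : ℝ) + 1) * A₂)
    (P : ℕ → ℤ) (Q : ℕ → Fin k → ℤ)
    (hlow : ∀ᶠ n : ℕ in Filter.atTop,
      Real.exp (-(A₁ * n)) ≤ |(P n : ℝ) + ∑ i, (Q n i : ℝ) * ξ i|)
    (hup : ∀ᶠ n : ℕ in Filter.atTop,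
      |(P n : ℝ) + ∑ i, (Q n i : ℝ) * ξ i| ≤ Real.exp (-(A₂ * n)))
    (hQ : ∀ᶠ n : ℕ in Filter.atTop, ∀ i, |(Q n i : ℝ)| ≤ Real.exp (B * n)) : False := by
  classical
  -- Step 0: no positive integer `q` makes all `q ξᵢ` integral, i.e. `Ψ(q) > 0` for `q ≥ 1`,
  -- where `Ψ(q) = ∑ᵢ |q ξᵢ - round (q ξᵢ)|` (`distSum ξ q`).
  have hR := fun (q : ℕ) (hq : 0 < q) => not_forall_nat_mul_eq_round ξ hA₂ P Q hlow hup hq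
  have hΨpos : ∀ q : ℕ, 0 < q → 0 < distSum ξ q := fun q hq =>
    lt_of_le_of_ne (distSum_nonneg ξ q) fun h0 => hR q hq fun i => by
      have h := (Finset.sum_eq_zero_iff_of_nonneg fun i _ => abs_nonneg _).1 h0.symm i
        (Finset.mem_univ i)
      exact sub_eq_zero.1 (abs_eq_zero.1 h)
  -- The case `k = 0`: `q = 1` already contradicts Step 0.
  rcases Nat.eq_zero_or_pos k with hk | hk
  · subst hk
    exact hR 1 one_pos fun i => i.elim0
  have hkr : (0 : ℝ) < k := by exact_mod_cast hk
  -- Step 1: thresholds — `n₀` for the three bounds, `q₀ ≥ e^{A₂ n₀}`, and the minimum `μ > 0`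
  -- of `Ψ` on `[1, q₀)`.
  obtain ⟨n₀, hn₀⟩ := eventually_atTop.1 (hlow.and (hup.and hQ))
  obtain ⟨q₀, hq₀⟩ : ∃ q₀ : ℕ, Real.exp (A₂ * n₀) ≤ q₀ := ⟨_, Nat.le_ceil _⟩
  obtain ⟨μ, hμ, hμS⟩ : ∃ μ : ℝ, 0 < μ ∧ ∀ q ∈ Finset.Ico 1 q₀, μ ≤ distSum ξ q := by
    by_cases hS : (Finset.Ico 1 q₀).Nonempty
    · obtain ⟨q₁, hq₁, hmin⟩ := Finset.exists_min_image (Finset.Ico 1 q₀) (distSum ξ) hS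
      exact ⟨distSum ξ q₁, hΨpos q₁ (Finset.mem_Ico.1 hq₁).1, hmin⟩
    · exact ⟨1, one_pos, fun q hq => (hS ⟨q, hq⟩).elim⟩
  -- The exponents `κ = B/A₂` (`k κ < 1`) and `θ = (A₁ + B)/A₂` (`θ ≥ 1`, `k (θ - 1) < 1`).
  set κ : ℝ := B / A₂ with hκ
  set θ : ℝ := (A₁ + B) / A₂ with hθ
  have hκA : κ * A₂ = B := div_mul_cancel₀ B hA₂.ne'
  have hθA : θ * A₂ = A₁ + B := div_mul_cancel₀ (A₁ + B) hA₂.ne'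
  have hκ0 : 0 ≤ κ := div_nonneg hB hA₂.le
  have hθ1 : 0 ≤ θ - 1 := by
    rw [sub_nonneg, hθ, le_div_iff₀ hA₂]
    linarith
  have hkκ : (k : ℝ) * κ < 1 := by
    refine lt_of_mul_lt_mul_right ?_ hA₂.le
    rw [mul_assoc, hκA, one_mul]
    exact hgap₁
  have hkθ : (k : ℝ) * (θ - 1) < 1 := by
    refine lt_of_mul_lt_mul_right ?_ hA₂.le
    rw [mul_assoc, sub_mul, hθA, one_mul]
    linarith
  set l2 : ℝ := Real.log 2 with hl2
  have hl2pos : 0 < l2 := Real.log_pos one_lt_two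
  have hhalf : Real.exp (-l2) = 1 / 2 := by
    rw [Real.exp_neg, hl2, Real.exp_log two_pos, one_div]
  set lk : ℝ := Real.log k with hlk
  have hexplk : Real.exp lk = k := by rw [hlk, Real.exp_log hkr]
  -- Step 2: the largeness conditions on `M` (on the scale `log M`), and an `M` beyond them.
  have hev : ∀ᶠ x : ℝ in atTop, lk + κ * l2 + B + l2 < x * (1 - k * κ) ∧
      lk + θ * l2 + (A₁ + B) < x * (1 - k * (θ - 1)) :=
    ((tendsto_id.atTop_mul_const (by linarith : (0 : ℝ) < 1 - k * κ)).eventually_gt_atTop _).and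
      ((tendsto_id.atTop_mul_const (by linarith : (0 : ℝ) < 1 - k * (θ - 1))).eventually_gt_atTop
        _)
  have hlogM : Tendsto (fun M : ℕ => Real.log M) atTop atTop :=
    Real.tendsto_log_atTop.comp tendsto_natCast_atTop_atTop
  have hlin : Tendsto (fun M : ℕ => μ * (M : ℝ)) atTop atTop :=
    (tendsto_natCast_atTop_atTop (R := ℝ)).const_mul_atTop hμ
  obtain ⟨M, hM⟩ := eventually_atTop.1
    ((eventually_ge_atTop 1).and ((hlin.eventually_gt_atTop (k : ℝ)).and (hlogM.eventually hev)))
  obtain ⟨hM1, hMk, hM2, hM3⟩ :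
      1 ≤ M ∧ (k : ℝ) < μ * M ∧ lk + κ * l2 + B + l2 < Real.log M * (1 - k * κ) ∧
        lk + θ * l2 + (A₁ + B) < Real.log M * (1 - k * (θ - 1)) := hM M le_rfl
  have hMpos : 0 < M := hM1
  have hMr : (0 : ℝ) < M := by exact_mod_cast hMpos
  set LM : ℝ := Real.log M with hLM
  have hexpLM : Real.exp LM = M := by rw [hLM, Real.exp_log hMr]
  -- Step 3: the simultaneous approximation `1 ≤ q ≤ M^k`, `|q ξᵢ - round (q ξᵢ)| < 1/M`.
  obtain ⟨q, hq0, hqM, hqi⟩ := exists_simultaneous_approx ξ hMpos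
  have hq0' : (0 : ℝ) < q := by exact_mod_cast hq0
  rcases lt_or_ge q q₀ with hlt | hge
  · -- `q < q₀`: then `μ ≤ Ψ(q) ≤ k/M < μ`.
    have h1 : μ ≤ distSum ξ q := hμS q (Finset.mem_Ico.2 ⟨hq0, hlt⟩)
    have h2 : distSum ξ q ≤ k / M :=
      calc distSum ξ q ≤ ∑ _i : Fin k, (1 : ℝ) / M := Finset.sum_le_sum fun i _ => (hqi i).le
        _ = k / M := by simp [Finset.sum_const, div_eq_mul_inv]
    have h3 : (k : ℝ) / M < μ := by
      rw [div_lt_iff₀ hMr]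
      linarith
    linarith
  -- `q ≥ q₀`: the index `n = ⌈log (2q) / A₂⌉` is `≥ n₀`, and `log q ≤ k log M`.
  set L : ℝ := Real.log q with hL
  have hexpL : Real.exp L = q := by rw [hL, Real.exp_log hq0']
  have h1 : A₂ * n₀ ≤ L := by
    rw [hL, ← Real.log_exp (A₂ * n₀)]
    exact Real.log_le_log (Real.exp_pos _) (hq₀.trans (by exact_mod_cast hge))
  have hLk : L ≤ k * LM := by
    rw [hL, hLM, ← Real.log_pow]
    exact Real.log_le_log hq0' (by exact_mod_cast hqM)
  have hL0 : 0 ≤ L := (mul_nonneg hA₂.le n₀.cast_nonneg).trans h1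
  set t : ℝ := (l2 + L) / A₂ with ht
  have hA₂t : A₂ * t = l2 + L := by rw [ht]; exact mul_div_cancel₀ (l2 + L) hA₂.ne'
  have ht0 : 0 ≤ t := by rw [ht]; exact div_nonneg (by linarith) hA₂.le
  set n : ℕ := ⌈t⌉₊
  have htn : t ≤ n := Nat.le_ceil t
  have hnt : (n : ℝ) < t + 1 := Nat.ceil_lt_add_one ht0
  have hn₀n : n₀ ≤ n := by
    have h : (n₀ : ℝ) ≤ t := by
      rw [ht, le_div_iff₀ hA₂]
      linarith
    exact_mod_cast h.trans htn
  obtain ⟨hlow', hup', hQ'⟩ := hn₀ n hn₀n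
  -- Exponent bookkeeping: `A₂ n ≥ log (2q)`, `B n ≤ κ (log 2 + k log M) + B`,
  -- `(A₁ + B) n ≤ θ (log 2 + log q) + A₁ + B`, `(θ - 1) log q ≤ (θ - 1) k log M`.
  have hA₂n : l2 + L ≤ A₂ * n := by
    have := mul_le_mul_of_nonneg_left htn hA₂.le
    linarith
  have hBn : B * n ≤ κ * l2 + κ * (k * LM) + B := by
    have hBt : B * t = κ * (l2 + L) := by rw [← hA₂t, ← mul_assoc, hκA]
    have h₁ := mul_le_mul_of_nonneg_left hnt.le hB
    have h₂ := mul_le_mul_of_nonneg_left hLk hκ0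
    linarith
  have hABn : (A₁ + B) * n ≤ θ * (l2 + L) + (A₁ + B) := by
    have hθt : (A₁ + B) * t = θ * (l2 + L) := by rw [← hA₂t, ← mul_assoc, hθA]
    have := mul_le_mul_of_nonneg_left hnt.le (by linarith : (0 : ℝ) ≤ A₁ + B)
    linarith
  have hθL : (θ - 1) * L ≤ (θ - 1) * (k * LM) := mul_le_mul_of_nonneg_left hLk hθ1
  -- Step 4: the form `ℓ = ℓ_n`, the error `E = ∑ᵢ Q_{n,i} (q ξᵢ - round (q ξᵢ))` and the
  -- integer `I = q P_n + ∑ᵢ Q_{n,i} round (q ξᵢ) = q ℓ - E`.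
  set ℓ : ℝ := (P n : ℝ) + ∑ i, (Q n i : ℝ) * ξ i with hℓ
  -- (a) `q |ℓ| ≤ q e^{-A₂ n} ≤ 1/2`.
  have hb1 : (q : ℝ) * |ℓ| ≤ 1 / 2 := by
    calc (q : ℝ) * |ℓ| ≤ q * Real.exp (-(A₂ * n)) := mul_le_mul_of_nonneg_left hup' hq0'.le
      _ = Real.exp (L - A₂ * n) := by rw [Real.exp_sub, Real.exp_neg, hexpL, div_eq_mul_inv]
      _ ≤ Real.exp (-l2) := Real.exp_le_exp.2 (by linarith)
      _ = 1 / 2 := hhalf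
  -- (b) `|E| ≤ ∑ᵢ |Q_{n,i}| / M ≤ k e^{B n} / M < 1/2` (this is where `k B < A₂` enters).
  have hb2 : |∑ i, (Q n i : ℝ) * ((q : ℝ) * ξ i - round ((q : ℝ) * ξ i))| ≤
      Real.exp (lk + B * n - LM) := by
    calc |∑ i, (Q n i : ℝ) * ((q : ℝ) * ξ i - round ((q : ℝ) * ξ i))|
        ≤ ∑ i, |(Q n i : ℝ) * ((q : ℝ) * ξ i - round ((q : ℝ) * ξ i))| :=
          Finset.abs_sum_le_sum_abs _ _
      _ ≤ ∑ _i : Fin k, Real.exp (B * n) * (1 / M) := Finset.sum_le_sum fun i _ => by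
          rw [abs_mul]
          exact mul_le_mul (hQ' i) (hqi i).le (abs_nonneg _) (Real.exp_pos _).le
      _ = k * (Real.exp (B * n) * (1 / M)) := by simp [Finset.sum_const]
      _ = Real.exp (lk + B * n - LM) := by
          rw [Real.exp_sub, Real.exp_add, hexplk, hexpLM]
          ring
  have hb2' : Real.exp (lk + B * n - LM) < 1 / 2 := by
    rw [← hhalf]
    exact Real.exp_lt_exp.2 (by linarith)
  set E : ℝ := ∑ i, (Q n i : ℝ) * ((q : ℝ) * ξ i - round ((q : ℝ) * ξ i)) with hE
  obtain ⟨I, hI⟩ : ∃ I : ℤ, (I : ℝ) = q * ℓ - E := by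
    refine ⟨q * P n + ∑ i, Q n i * round ((q : ℝ) * ξ i), ?_⟩
    rw [hℓ, hE]
    push_cast
    rw [mul_add, Finset.mul_sum, add_sub_assoc, ← Finset.sum_sub_distrib]
    congr 1
    exact Finset.sum_congr rfl fun i _ => by ring
  -- (c) `|I| ≤ q |ℓ| + |E| < 1`, so `I = 0`.
  have hI0 : I = 0 := by
    have h : |(I : ℝ)| < 1 := by
      rw [hI]
      calc |(q : ℝ) * ℓ - E| ≤ |(q : ℝ) * ℓ| + |E| := abs_sub _ _
        _ = q * |ℓ| + |E| := by rw [abs_mul, Nat.abs_cast]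
        _ < 1 := by linarith
    have h' : ((|I| : ℤ) : ℝ) < (1 : ℤ) := by rw [Int.cast_abs, Int.cast_one]; exact h
    exact Int.abs_lt_one_iff.1 (Int.cast_lt.1 h')
  -- Step 5: `q ℓ = E`, so the lower bound transfers: `q e^{-A₁ n} ≤ q |ℓ| = |E| ≤ k e^{B n} / M`.
  have hqℓ : (q : ℝ) * ℓ = E := sub_eq_zero.1 (by rw [← hI, hI0, Int.cast_zero])
  have hb3 : Real.exp (L - A₁ * n) ≤ Real.exp (lk + B * n - LM) := by
    calc Real.exp (L - A₁ * n) = q * Real.exp (-(A₁ * n)) := by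
          rw [Real.exp_sub, Real.exp_neg, hexpL, div_eq_mul_inv]
      _ ≤ q * |ℓ| := mul_le_mul_of_nonneg_left hlow' hq0'.le
      _ = |E| := by rw [← hqℓ, abs_mul, Nat.abs_cast]
      _ ≤ Real.exp (lk + B * n - LM) := hb2
  have hfin : L - A₁ * n ≤ lk + B * n - LM := Real.exp_le_exp.1 hb3
  -- `log M ≤ log k + (A₁ + B) n - log q ≤ log k + θ log 2 + A₁ + B + (θ - 1) k log M < log M`.
  linarith

end Literature.NumberTheory.DiophantineApproximation
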